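import Summits.CriticalPhenomena.PercolationContinuityZ3.Theses.PercExchangeRateTransport
import Summits.CriticalPhenomena.PercolationContinuityZ3.Theorems.SubcritExchangeUniformity.Negative.DiagonalIdentity
import Summits.CriticalPhenomena.PercolationContinuityZ3.Theorems.PercExchangeRateTransportSubcritExchangeUniformityRussoPos
import Summits.CriticalPhenomena.PercolationContinuityZ3.Theorems.PercExchangeRateTransportModelFacts

/-!
# `SupercritExchangeUniformity` (K⁺, crux stmt-CriticalPhenomena-16061, route `PercExchangeRateTransport`),
# negative lane, part 1: the sub-planar half-plane `{t ≤ 0}` — the hypothesis `0 < lo` is load-bearing AS TYPED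

Guard / load-bearing lemmas from the crux disprover of K⁺ (cdisprove, cycle 1). Nothing in this file
asserts the crux (or any Theses decl) positively; no definitions. The crux's `let`-objects are the
named objects of the sibling lane `…Theorems.SubcritExchangeUniformity.Negative.Objects`
(`ThetaBox = Θ`, `thetaPerc = θ`, `pcurve = pc`, `param`, by `rfl`).

K⁺ reads: for every compact sub-arc `[lo,hi] ⊂ (0,1)` there are `ρ > 0`, `L`, and a field `a(p,t)`,
continuous on the closed collar `{t ∈ [lo,hi], p_c(t) ≤ p ≤ p_c(t) + ρ}` and `L`-Lipschitz in `p`,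
with `|∂_tΘ_n(p,t) − a(p,t) ∂_pΘ_n(p,t)| ≤ η ∂_pΘ_n(p,t)` on the collar for `n ≥ m(η)` (all `deriv`s
are Mathlib's `deriv`).

* §1 (`param_of_t_nonpos`, `ThetaBox_of_t_nonpos`, `deriv_t_eq_zero_of_nonpos`): for `t ≤ 0` the
  clamp `projIcc 0 1 t = 0` kills every vertical bond, the family does not see `t`, and
  `deriv (fun s => Θ_n(p,s)) t = 0` for EVERY `t ≤ 0` and every real `p` (at the corner `t = 0` by
  uniqueness of derivatives within `Iic 0` — the slice is in fact NOT differentiable there for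
  `n ≥ 1`, `p ∈ (0,1)`, its right derivative being the positive vertical Russo sum — or junk `0`).
  Likewise `thetaPerc p t = thetaPerc p 0` and `pcurve t = pcurve 0` (`pcurve_of_t_nonpos`), and
  `pcurve 0 = 1/2` (`pcurve_zero`: the landed `ModelFacts` planar clause + Kesten's theorem), so the
  sub-planar part of a K⁺ collar is the rectangle `[1/2, 1/2 + ρ] × [lo, 0]`.
* §2 (`deriv_p_pos_of_t_lt_one`): `0 < ∂_pΘ_n(p,t)` for `n ≥ 1`, `p ∈ (0,1)` and EVERY `t < 1`
  (the straight open `x`-path cylinder of `RussoPos` has positive weight as soon as `p ∈ (0,1)` and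
  no parameter equals `1`; no positivity of `t` is needed) — so on `{t ≤ 0}` the horizontal
  derivative is alive while the vertical one is dead, the mirror image of the K⁻ lane's `{p ≤ 0}`.
* §3 (`rate_eq_zero_of_clause_t_nonpos`, `witness_vanishes_below_planar_end`): consequently the
  exchange-rate inequality of K⁺ at a level `t ≤ 0`, demanded for every `η > 0`, forces
  `a(p,t) = 0` at every `p ∈ (0,1)` of the collar. THE HYPOTHESIS `0 < lo` IS WHAT KEEPS THIS OUT:
  the lo-free variant of K⁺ (arcs `[lo,hi]` with `lo ≤ 0 < hi < 1`) forces its witness to vanish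
  identically on `[1/2, 1/2+ρ] × [lo,0] ∩ {p < 1}` while being continuous on the whole collar.
  Whether that variant is actually FALSE is NOT settled here: a contradiction with the levels
  `t ↓ 0` needs (i) right-continuity of the anisotropic critical curve at the planar end,
  `p_c(t) → p_c(ℤ²) = 1/2` (dimensional-crossover continuity; in print for slabs/layers, e.g.
  arXiv:1706.07495, not in the tree for this family), to make the collars at `t > 0` accumulate at the
  sub-planar rectangle, and (ii) a lower bound `a_n(p,t) ≥ κ > 0` uniform in `n ≥ m` near the planar
  end (physically `a(p_c(t),t) = −p_c′(t) → +∞` like `t^{1/φ−1}`, crossover exponent `φ = γ₂ = 43/18`,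
  so the variant is false for a blow-up reason, but no uniform-in-`n` comparability constant is in
  the tree). Recorded as a near-miss in the crux work file `Cruxes/SupercritExchangeUniformity/Disproof.lean`.

Tree lemmas used: `Objects` (`param_of_mem`, `τPT_of_vert`, `ThetaBox_eq`, `map_cfgPT`, …),
`Diag.hasDerivAt_ThetaBox_p`, `Diag.dir_unique`, `RussoPos.localCylinder_axisPath_subset_isPivotal`,
`axisBond_zero_mem_sym2_box`, `axisBond_zero_mem_edgeSet`, `xBond_zero_not_vert`,
`prodBernoulli_real_localCylinder`, `ModelFacts.modelFacts_proof` (planar clause),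
`Kesten1980_theta_eq_zero`, `Kesten1980_theta_pos_holds`; Mathlib `uniqueDiffOn_Iic`,
`UniqueDiffWithinAt.eq_deriv`, `deriv_zero_of_not_differentiableAt`, `csInf_Ioc`.
-/

noncomputable section

namespace Summit.CriticalPhenomena.PercolationContinuityZ3.Theorems.SupercritExchangeUniformity.Negative

open MeasureTheory Filter Topology
open Literature.Probability.Percolation Literature.Probability.LatticeModels
open Literature.Probability.Percolation.DCT16
open Summit.CriticalPhenomena.PercolationContinuityZ3.Theorems.SubcritExchangeUniformity.Negative
open Summit.CriticalPhenomena.PercolationContinuityZ3.Theorems.SubcritExchangeUniformity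
  (localCylinder_axisPath_subset_isPivotal axisBond_zero_mem_sym2_box axisBond_zero_mem_edgeSet
    xBond_zero_not_vert zdGraph_adj_single_succ)

/-! ## §1 The half-plane `{t ≤ 0}`: the family is constant in `t`, so `∂_tΘ_n = 0` there -/

/-- On `{t ≤ 0}` the parameter field is that of `t = 0` (the clamp `projIcc 0 1 t = 0`). [folklore] -/
theorem param_of_t_nonpos (p : ℝ) {t : ℝ} (ht : t ≤ 0) : param p t = param p 0 := by
  funext e
  by_cases he : e ∈ (zdGraph 3).edgeSet
  · rw [param_of_mem he, param_of_mem he]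
    by_cases hv : e ∈ vertBonds
    · rw [τPT_of_vert hv, τPT_of_vert hv, Set.projIcc_of_le_left _ ht, Set.projIcc_left]
    · rw [τPT_of_not_vert hv, τPT_of_not_vert hv]
  · rw [param_of_not_mem he, param_of_not_mem he]

/-- **`Θ_n(p,t) = Θ_n(p,0)` for `t ≤ 0`**: below the planar end no vertical bond is open, the model is
"horizontal-only" (independent planes) and does not see `t`. [folklore] -/
theorem ThetaBox_of_t_nonpos (n : ℕ) (p : ℝ) {t : ℝ} (ht : t ≤ 0) :
    ThetaBox n p t = ThetaBox n p 0 := by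
  rw [ThetaBox_eq, ThetaBox_eq, param_of_t_nonpos p ht]

/-- **`∂_tΘ_n(p,t) = 0` for every `t ≤ 0`** and every real `p` (Mathlib's `deriv`, as in the crux):
the `t`-slice is constant on `(-∞, 0]`; at `t < 0` the derivative is honestly `0`, at the corner
`t = 0` either the slice is differentiable (then its derivative is the left one, `0`, by uniqueness of
derivatives within `Iic 0`) or it is not (then `deriv` is `0` by convention). [folklore] -/
theorem deriv_t_eq_zero_of_nonpos (n : ℕ) (p : ℝ) {t : ℝ} (ht : t ≤ 0) :
    deriv (fun s => ThetaBox n p s) t = 0 := by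
  by_cases hd : DifferentiableAt ℝ (fun s => ThetaBox n p s) t
  · have h1 : HasDerivWithinAt (fun s => ThetaBox n p s) (deriv (fun s => ThetaBox n p s) t)
        (Set.Iic 0) t :=
      hd.hasDerivAt.hasDerivWithinAt
    have h2 : HasDerivWithinAt (fun s => ThetaBox n p s) 0 (Set.Iic 0) t :=
      (hasDerivWithinAt_const (x := t) (s := Set.Iic 0) (c := ThetaBox n p 0)).congr_of_mem
        (fun s hs => ThetaBox_of_t_nonpos n p hs) ht
    exact (uniqueDiffOn_Iic 0 t ht).eq_deriv _ h1 h2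
  · exact deriv_zero_of_not_differentiableAt hd

/-- `θ(p,t)` is the `prodBernoulli (param p t)`-probability of `{|C(0)| = ∞}`. [folklore] -/
theorem thetaPerc_eq (p t : ℝ) :
    thetaPerc p t = (prodBernoulli (param p t)).real (percolatesAt (0 : Site 3)) := by
  rw [thetaPerc, ← map_cfgPT p t, measureReal_def, measureReal_def,
    Measure.map_apply (measurable_cfgPT p t) (measurableSet_percolatesAt_holds 0)]
  rfl

/-- `θ(p,t) = θ(p,0)` for `t ≤ 0`. [folklore] -/
theorem thetaPerc_of_t_nonpos (p : ℝ) {t : ℝ} (ht : t ≤ 0) : thetaPerc p t = thetaPerc p 0 := by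
  rw [thetaPerc_eq, thetaPerc_eq, param_of_t_nonpos p ht]

/-- **`p_c(t) = p_c(0)` for `t ≤ 0`**: the critical curve is frozen below the planar end. [folklore] -/
theorem pcurve_of_t_nonpos {t : ℝ} (ht : t ≤ 0) : pcurve t = pcurve 0 := by
  unfold pcurve
  simp_rw [thetaPerc_of_t_nonpos _ ht]

/-- The planar clause of the landed route item `ModelFacts`: `θ(p,0) = θ_{ℤ²}(p)` for `p ∈ [0,1]`.
[folklore] -/
theorem thetaPerc_zero_eq {p : ℝ} (h0 : 0 ≤ p) (h1 : p ≤ 1) :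
    thetaPerc p 0 = theta (zdGraph 2) (0 : Site 2) ⟨p, h0, h1⟩ :=
  (Summit.CriticalPhenomena.PercolationContinuityZ3.Theorems.ModelFacts.modelFacts_proof).2.2.2.2.2.2.2.2.2
    ⟨p, h0, h1⟩

/-- **`p_c(0) = 1/2`** (the planar end of the curve is Kesten's critical point): the defining set
`{p ∈ [0,1] | θ(p,0) > 0} ∪ {1}` is `(1/2, 1]` by `ModelFacts` (planar clause) and Kesten's theorem
(`θ_{ℤ²} = 0` on `[0,1/2]`, `> 0` on `(1/2,1]`). [folklore] -/
theorem pcurve_zero : pcurve 0 = 1 / 2 := by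
  have hS : ({p : ℝ | 0 ≤ p ∧ p ≤ 1 ∧ 0 < thetaPerc p 0} ∪ {1}) = Set.Ioc (1 / 2 : ℝ) 1 := by
    ext p
    simp only [Set.mem_union, Set.mem_setOf_eq, Set.mem_singleton_iff, Set.mem_Ioc]
    constructor
    · rintro (⟨h0, h1, hpos⟩ | rfl)
      · refine ⟨?_, h1⟩
        by_contra hle
        rw [not_lt] at hle
        rw [thetaPerc_zero_eq h0 h1, Kesten1980_theta_eq_zero ⟨p, h0, h1⟩ hle] at hpos
        exact lt_irrefl _ hpos
      · norm_num
    · rintro ⟨h1, h2⟩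
      refine Or.inl ⟨by linarith, h2, ?_⟩
      rw [thetaPerc_zero_eq (by linarith) h2]
      exact Kesten1980_theta_pos_holds _ h1
  rw [pcurve, hS]
  exact csInf_Ioc (by norm_num)

/-- **For `t ≤ 0` the critical curve sits at `1/2`**, so the sub-planar part of a K⁺ collar
`{p_c(t) ≤ p ≤ p_c(t) + ρ}` is the rectangle `[1/2, 1/2 + ρ] × {t ≤ 0}`. [folklore] -/
theorem pcurve_eq_half_of_nonpos {t : ℝ} (ht : t ≤ 0) : pcurve t = 1 / 2 := by
  rw [pcurve_of_t_nonpos ht, pcurve_zero]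

/-! ## §2 `0 < ∂_pΘ_n(p,t)` for `n ≥ 1`, `p ∈ (0,1)` and every `t < 1` -/

/-- The horizontal Russo weights are nonnegative. [folklore] -/
theorem wh_nonneg (e : Sym2 (Site 3)) : 0 ≤ Diag.wh e := by
  simp only [Diag.wh]
  split_ifs <;> norm_num

/-- The parameters of the family are `< 1` everywhere as soon as `p < 1` and `t < 1`
(no positivity of `t` needed). [folklore] -/
theorem param_lt_one_of_lt {p t : ℝ} (hp : p < 1) (ht : t < 1) (e : Sym2 (Site 3)) :
    (param p t e : ℝ) < 1 := by
  by_cases he : e ∈ (zdGraph 3).edgeSet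
  · rw [param_of_mem he]
    by_cases hv : e ∈ vertBonds
    · rw [τPT_of_vert hv, Set.coe_projIcc]
      exact max_lt zero_lt_one (min_lt_iff.2 (Or.inr ht))
    · rw [τPT_of_not_vert hv, Set.coe_projIcc]
      exact max_lt zero_lt_one (min_lt_iff.2 (Or.inr hp))
  · rw [param_of_not_mem he]
    exact zero_lt_one

/-- The bonds `s(k e₁, (k+1) e₁)` of the straight `x`-path are `x`-bonds. [folklore] -/
theorem xPathBond_mem_dirBonds (k : ℤ) :
    s((Pi.single 0 k : Site 3), Pi.single 0 (k + 1)) ∈ Diag.dirBonds 0 :=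
  ⟨Pi.single 0 k, by rw [← Pi.single_add (f := fun _ : Fin 3 => ℤ) 0 k 1]⟩

/-- The bonds of the straight `x`-path are not vertical. [folklore] -/
theorem xPathBond_not_vert (k : ℤ) :
    s((Pi.single 0 k : Site 3), Pi.single 0 (k + 1)) ∉ vertBonds := fun h =>
  absurd (Diag.dir_unique (xPathBond_mem_dirBonds k) (show _ ∈ Diag.dirBonds 2 from h)) (by decide)

/-- **`P_{(p,t)}(s(0, e₁) pivotal for {0 ↔ ∂Λ_n}) > 0`** for `n ≥ 1`, `p ∈ (0,1)` and every `t < 1`: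
the straight open `x`-path cylinder (`RussoPos.localCylinder_axisPath_subset_isPivotal`) has weight
`∏ (p or 1 − param) > 0` — its open bonds are horizontal (weight `p > 0`), every other pair of `Λ_n`
has weight `1 − param > 0` because no parameter reaches `1`. [folklore] -/
theorem real_isPivotal_xBond_pos {p t : ℝ} (hp : p ∈ Set.Ioo (0 : ℝ) 1) (ht : t < 1) {n : ℕ}
    (hn : 1 ≤ n) :
    0 < (prodBernoulli (param p t)).real
      {ω | IsPivotal (siteToBoundary 3 n) s((0 : Site 3), Pi.single 0 1) ω} := by
  classical
  refine lt_of_lt_of_le ?_ (measureReal_mono (localCylinder_axisPath_subset_isPivotal 0 hn))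
  rw [Literature.Probability.Percolation.prodBernoulli_real_localCylinder]
  refine Finset.prod_pos fun e _ => ?_
  split_ifs with he
  · obtain ⟨k, -, -, rfl⟩ := he
    have hE : s((Pi.single 0 (k : ℤ) : Site 3), Pi.single 0 ((k : ℤ) + 1)) ∈ (zdGraph 3).edgeSet :=
      (SimpleGraph.mem_edgeSet _).2 (zdGraph_adj_single_succ 0 (k : ℤ))
    rw [param_of_mem hE, τPT_of_not_vert (xPathBond_not_vert (k : ℤ)),
      Set.projIcc_of_mem _ (Set.Ioo_subset_Icc_self hp)]
    exact hp.1
  · exact sub_pos.2 (param_lt_one_of_lt hp.2 ht e)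

/-- **`0 < ∂_pΘ_n(p,t)` for `n ≥ 1`, `p ∈ (0,1)` and every real `t < 1`** — in particular on the
whole sub-planar half-plane `{t ≤ 0}` where `∂_tΘ_n = 0`: by the two-parameter Russo formula in
the `p`-direction (`Diag.hasDerivAt_ThetaBox_p`, valid for every real `t`) the derivative is a sum of
nonnegative terms whose `s(0, e₁)` term is positive. [folklore] -/
theorem deriv_p_pos_of_t_lt_one {n : ℕ} (hn : 1 ≤ n) {p : ℝ} (hp : p ∈ Set.Ioo (0 : ℝ) 1) {t : ℝ}
    (ht : t < 1) : 0 < deriv (fun q => ThetaBox n q t) p := by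
  rw [(Diag.hasDerivAt_ThetaBox_p n hp t).deriv]
  have hnn : ∀ e ∈ (box 3 n).sym2,
      0 ≤ Diag.wh e * (prodBernoulli (param p t)).real {ω | IsPivotal (siteToBoundary 3 n) e ω} :=
    fun e _ => mul_nonneg (wh_nonneg e) measureReal_nonneg
  refine lt_of_lt_of_le ?_ (Finset.single_le_sum hnn (axisBond_zero_mem_sym2_box 0 hn))
  rw [Diag.wh_of_not_vert (axisBond_zero_mem_edgeSet 0) xBond_zero_not_vert, one_mul]
  exact real_isPivotal_xBond_pos hp ht hn

/-! ## §3 The K⁺ inequality at a sub-planar level forces the rate to vanish -/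

/-- **At a level `t ≤ 0` the exchange-rate inequality of K⁺, demanded for every `η > 0`, forces the
rate to be `0`.** If `|∂_tΘ_n(p,t) − a₀ ∂_pΘ_n(p,t)| ≤ η ∂_pΘ_n(p,t)` holds for all `η > 0` and all
`n ≥ m(η)` at a point `p ∈ (0,1)`, `t ≤ 0`, then `a₀ = 0`: there `∂_tΘ_n = 0 < ∂_pΘ_n`, so the
inequality reads `|a₀| ∂_pΘ_n ≤ η ∂_pΘ_n`. [folklore] -/
theorem rate_eq_zero_of_clause_t_nonpos {t : ℝ} (ht : t ≤ 0) {p : ℝ} (hp : p ∈ Set.Ioo (0 : ℝ) 1)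
    {a₀ : ℝ}
    (h : ∀ η > (0 : ℝ), ∃ m : ℕ, ∀ n ≥ m,
      |deriv (fun s => ThetaBox n p s) t - a₀ * deriv (fun q => ThetaBox n q t) p| ≤
        η * deriv (fun q => ThetaBox n q t) p) :
    a₀ = 0 := by
  by_contra hne
  have hpos : 0 < |a₀| := abs_pos.2 hne
  obtain ⟨m, hm⟩ := h (|a₀| / 2) (half_pos hpos)
  have key := hm (max m 1) (le_max_left _ _)
  have hD := deriv_p_pos_of_t_lt_one (le_max_right m 1) hp (ht.trans_lt zero_lt_one)
  rw [deriv_t_eq_zero_of_nonpos _ p ht, zero_sub, abs_neg, abs_mul, abs_of_pos hD] at key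
  have := mul_lt_mul_of_pos_right (half_lt_self hpos) hD
  linarith

/-- **A K⁺ witness vanishes identically below the planar end.** If a field `a` satisfies the
`η`-clause of K⁺ on an arc `[lo,hi]` and a collar of width `ρ` (for every `η > 0`, some `m(η)`),
then `a(p,t) = 0` at every level `t ∈ [lo,hi]` with `t ≤ 0` and every `p ∈ (0,1)` of the collar
`[p_c(t), p_c(t) + ρ] = [1/2, 1/2 + ρ]` (`pcurve_eq_half_of_nonpos`). With `0 < lo` (the crux as
stated) the hypothesis `t ≤ 0` is never met: this is exactly what the guard `0 < lo` buys.
[folklore] -/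
theorem witness_vanishes_below_planar_end {lo hi ρ : ℝ} {a : ℝ → ℝ → ℝ}
    (h : ∀ η > (0 : ℝ), ∃ m : ℕ, ∀ n ≥ m, ∀ t ∈ Set.Icc lo hi, ∀ p : ℝ,
      pcurve t ≤ p → p ≤ pcurve t + ρ →
        |deriv (fun s => ThetaBox n p s) t - a p t * deriv (fun q => ThetaBox n q t) p| ≤
          η * deriv (fun q => ThetaBox n q t) p)
    {t : ℝ} (htI : t ∈ Set.Icc lo hi) (ht : t ≤ 0) {p : ℝ} (hp : p ∈ Set.Ioo (0 : ℝ) 1)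
    (h1 : pcurve t ≤ p) (h2 : p ≤ pcurve t + ρ) : a p t = 0 :=
  rate_eq_zero_of_clause_t_nonpos ht hp fun η hη =>
    (h η hη).imp fun _ hm n hn => hm n hn t htI p h1 h2

/-- **The sub-planar collar is non-degenerate**: for `t ≤ 0` and `0 < ρ` the points
`p ∈ (1/2, min (1/2 + ρ) 1)` lie in the collar AND in the open strip `0 < p < 1`, so
`witness_vanishes_below_planar_end` has content (e.g. at `p = 1/2 + min ρ (1/4)`). [folklore] -/
theorem subplanar_collar_point {t ρ : ℝ} (ht : t ≤ 0) (hρ : 0 < ρ) :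
    (1 / 2 + min ρ (1 / 4)) ∈ Set.Ioo (0 : ℝ) 1 ∧ pcurve t ≤ 1 / 2 + min ρ (1 / 4) ∧
      1 / 2 + min ρ (1 / 4) ≤ pcurve t + ρ := by
  rw [pcurve_eq_half_of_nonpos ht]
  refine ⟨⟨?_, ?_⟩, ?_, ?_⟩
  · have := lt_min hρ (by norm_num : (0 : ℝ) < 1 / 4)
    linarith
  · have := min_le_right ρ (1 / 4 : ℝ)
    linarith
  · have := (lt_min hρ (by norm_num : (0 : ℝ) < 1 / 4)).le
    linarith
  · have := min_le_left ρ (1 / 4 : ℝ)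
    linarith

end Summit.CriticalPhenomena.PercolationContinuityZ3.Theorems.SupercritExchangeUniformity.Negative

end
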